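import Literature.AlgebraicGeometry.Resolution.AbhyankarInvariants
import Mathlib.RingTheory.Etale.Locus
import Mathlib.FieldTheory.PurelyInseparable.Basic
import HarnessLib

/-!
# Toric charts, toroidal models and the log-free frontier of Temkin's Thm. 5.5.2 (Temkin 2013, §§5.3–5.5)

Topic: `Literature/AlgebraicGeometry/Resolution`. Vocabulary and named facts for the decomposition
of the named fact `Temkin2013Abhyankar` (`InseparableLocalUniformizationAbhyankar.lean`;
M. Temkin, *Inseparable local uniformization*, J. Algebra 373 (2013) 65–119 = arXiv:0804.1554v3 —
all numbers and pages below are those of this version —, Thm. 5.5.2 (i) for `n = 1`, logarithmic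
data dropped) into the results of §§5.3–5.5 of the source from which its printed proof (pp. 60–61)
assembles it. For ONE finite extension `K₁/K` (`n = 1`) and the conclusion "`x₁` is a simple
`l`-smooth point, `X'` refines `X`", that proof uses no logarithmic geometry beyond the following
LOG-FREE statements, which are therefore what is vendored here:

* **§5.3 (pp. 54–56), definitions.** For a finitely generated Abhyankar valued field `K` over the
  trivially valued `k ⊆ K°` (`transcendenceDefect k O hk = 0`, `TranscendenceDefect.lean`), the
  value group `Λ = |K^×|` is a lattice (`AbhyankarInvariants.lean`) with valuation monoid
  `Λ° = |K° ∖ {0}|` (`valuationMonoid`); a toric monoid `M ⊆ Λ` with `M^gp = Λ` (`IsToricMonoid`: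
  finitely generated, saturated in `Λ`, generating `Λ`); an Abhyankar transcendence basis
  `B = B_E ⊔ B_F` (`IsAbhyankarBasis`: condition (*) of §2.1, p. 9, and "transcendence basis");
  the toric chart `A_{B,M} = Spec k[M_B]`, `M_B = P_B^× ⊕ (M ∩ Λ_B)` (`toricChart`: the
  `k`-subalgebra of `K` generated by `B_F^{±1}` and the Laurent monomials in `B_E` whose value
  lies in `M`).
* **§5.4 (p. 56), definitions.** `X_{B,M} = Nr_K(A_{B,M})` (`nrAlg`: integral closure inside `K`),
  the centre `x_{B,M}` of `K°` on it (`centreIdeal`, `LocalUniformization.lean`) and its local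
  ring `A_{B,M} ⊆ K°` (`centreLocalRing`: the fractions `a / b`, `a, b ∈ Nr`, `|b| = 1`).
* `Temkin2013_Prop543` — NAMED FACT, **Prop. 5.4.3** (independence of the basis): for two
  Abhyankar bases `B, B'` and every sufficiently large toric `M ⊆ Λ°`, `A_{B,M} = A_{B',M}` in
  `K`, and `i_B(m) = u · i_{B'}(m)` with `u ∈ A_{B,M}^×` for `m ∈ M ∩ Λ_B ∩ Λ_{B'}`.
* `Temkin2013_Thm551iii` — NAMED FACT, **Thm. 5.5.1 (iii)**: if `B̃_F` is a separating
  transcendence basis of `K̃/k` and `|B_E|` is a basis of `|K^×|`, then for every sufficiently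
  large toric `M ⊆ Λ°` the projection `f_{B,M} : X_{B,M} → A_{B,M}` is étale at `x_{B,M}`
  (`Algebra.IsEtaleAt`).
* `Temkin2013_Thm553` — NAMED FACT, **Thm. 5.5.3**: there is a finite purely inseparable `l/k`
  such that for every finite purely inseparable `l'/l` the residue field of `l'K` is separable
  (separably generated) over `l'`.
* PROVED API: `Λ°` is a valuation monoid; charts, normalizations and local rings lie in `K°` and
  grow with `M` (`toricChart_le_valuationSubring`, `nrAlg_le_valuationSubring`,
  `centreLocalRing_le_valuationSubring`, `toricChart_mono`, `nrAlg_mono`, `centreLocalRing_mono`),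
  `le_nrAlg`, `le_centreLocalRing`, membership lemmas.

Cor. 5.4.2 (`K° = ⋃_M A_{B,M}`), Thm. A.2.1 (PROVED, `PerronTransforms.lean`) and the assembly of
`Temkin2013Abhyankar` from these facts (proof of Thm. 5.5.2, pp. 60–61, for `n = 1`: Thm. 5.5.3
for `K₁` gives `l`; an adapted basis `B'` of `L₁ = lK₁` over `l`; Thm. 5.5.1 (iii) for
`(L₁, l, B')`; Prop. 5.4.3 for `L₁/l` and the bases `B ⊂ K`, `B'`; a free `M` by Thm. A.2.1;
Cor. 5.4.2 to refine the prescribed model) are carried out in companion files. The deep inputs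
of the printed proofs of the three facts are: the (generalized) stability theorem (Remark 2.1.3,
[Kuh]), [EGA IV₄ 17.7.8] and the Riemann–Zariski spaces of §2.4 (Lemmas 5.4.1, 5.4.4).

## Sources

* M. Temkin, *Inseparable local uniformization*, J. Algebra 373 (2013) 65–119 =
  arXiv:0804.1554v3: §2.1 (pp. 8–10: valued fields, condition (*), Abhyankar transcendence
  bases, Remark 2.1.3); §5.3 (pp. 54–56: `Λ`, `Λ°`, `K_B`, `Λ_B`, `M_B`, `A_{B,M}`, Lemmas
  5.3.1–5.3.2); §5.4 (pp. 56–59: `X_{B,M}`, `x_{B,M}`, `A_{B,M}`, Cor. 5.4.2, Prop. 5.4.3); §5.5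
  (pp. 59–62: Thms. 5.5.1, 5.5.2, 5.5.3); App. A (p. 62: toric monoids, saturation, Kummer
  homomorphisms; valuation monoids).

## Rendering notes

* Valued fields as in the companion files: `O = K°` a `ValuationSubring K`; the trivially valued
  ground field `k ⊆ K°` ↦ `hk : ∀ c, algebraMap k K c ∈ O` (`algebraOfMem` for residues);
  `Λ = |K^×|` ↦ the units `(ValuationSubring.ValueGroup O)ˣ` of Mathlib's value group with zero,
  the value of `a ≠ 0` ↦ `Units.mk0 (O.valuation a) _`; "`|m| ∈ M`" for `m ∈ K` ↦
  `∃ γ ∈ M, (γ : ValueGroup O) = O.valuation m`.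
* "Toric monoid `M ⊂ Λ` such that `M^gp = Λ`" (§5.3, p. 55: "Next portion of notation will be
  associated with a toric monoid `M ⊂ Λ` such that `M^gp = Λ`"; App. A.1: toric = fine, saturated,
  `M^gp` a lattice) ↦ `IsToricMonoid`: `M.FG`, saturated in `Λ`, `Subgroup.closure M = ⊤`; "for any
  sufficiently large toric `M ⊆ Λ°`" ↦ the pedantic form of p. 55: `∃ M₀` toric `⊆ Λ°`, `∀ M`
  toric with `M₀ ≤ M ⊆ Λ°`.
* An Abhyankar transcendence basis is a pair of finite families `x : Fin E → K` (`B_E`) and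
  `y : Fin F → K°` (`B_F`) (the shape of `ToricUniformization.lean`/`AbhyankarInvariants.lean`).
  Laurent monomials `x^d`, `d ∈ ℤ^E`, are `d.prod fun j n => x j ^ n` (`lmonomial_*`,
  `ToricUniformization.lean`); `i_B(m)` for `m ∈ M ∩ Λ_B` is the monomial `x^d` of value `m`.
* The chart `k[M_B]`: the source's `M_B = P_B^× ⊕ M_B°` with `P_B^×` the free abelian group on
  `B_F`, so `k[M_B] = k[B_F^{±1}][x^d : |x^d| ∈ M]`; rendered as `Algebra.adjoin` of exactly these
  elements (`toricChart`). `Nr_K` ↦ `nrAlg` (Mathlib's `integralClosure`, scalars restricted to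
  `k`); the local ring `A_{B,M}` ↦ the explicit subalgebra `centreLocalRing` of `K` (so that
  Prop. 5.4.3's "the local rings `A_M` and `A'_M` in `K` coincide" is an equality of subalgebras);
  "`f_{B,M}` is étale at `x_{B,M}`" ↦ Mathlib's `Algebra.IsEtaleAt k[M_B] 𝔭` for the prime
  `𝔭 = x_{B,M}` of `Nr_K(k[M_B])` (formal étaleness of the local ring; `Nr_K(k[M_B])` is finite
  over the Noetherian `k[M_B]`, so this is étaleness at the point, Mathlib
  `Algebra.exists_etale_of_isEtaleAt`).
* Thm. 5.5.3: "`l̃'K` is separable over `l'`" for the finitely generated (Remark 2.1.3) residue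
  field ↦ separably generated (a finite separating transcendence basis), which for finitely
  generated extensions is equivalent (MacLane) and is the form the source uses (proof of
  Thm. 5.5.1, p. 59: "`K̃` is separable over `k` and hence admits a separating transcendence
  basis"). The compositum `l'K` ↦ any field `K'` with compatible maps from `K` and `l'` and
  `Algebra.adjoin K l' = ⊤`, with any valuation ring `O'` over `K°` (it is unique, `l'K/K` being
  purely inseparable).
* Prop. 5.4.3's last sentence ("In particular, the divisors on `Spec(A_M)` induced from `E_M` and
  `E'_M` coincide") and Thm. 5.5.1 (i)–(ii) (log smoothness, Kummer property, sharp monoidal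
  stalks) are logarithmic and are not rendered.
-/

noncomputable section

namespace Literature.AlgebraicGeometry.Resolution

open IsLocalRing ValuationSubring

universe u

variable {k K : Type u} [Field k] [Field K] [Algebra k K] (O : ValuationSubring K)

/-! ### The valuation monoid `Λ° = |K° ∖ {0}|` and toric monoids in `Λ = |K^×|` -/

/-- The **valuation monoid** `Λ° = |K° ∖ {0}|` of the value group `Λ = |K^×|` (Temkin 2013, §5.3,
p. 55; App. A.2, p. 62): the values `≤ 1`. [cite: Temkin2013, Section 5.3 (p. 55)] -/
def valuationMonoid : Submonoid (ValueGroup O)ˣ where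
  carrier := {γ | (γ : ValueGroup O) ≤ 1}
  one_mem' := by simp
  mul_mem' := fun {a b} ha hb => by
    simp only [Set.mem_setOf_eq, Units.val_mul] at ha hb ⊢
    exact mul_le_one' ha hb

/-- Membership in `Λ°`: the value is `≤ 1`. [folklore] -/
@[simp] theorem mem_valuationMonoid_iff {γ : (ValueGroup O)ˣ} :
    γ ∈ valuationMonoid O ↔ (γ : ValueGroup O) ≤ 1 := Iff.rfl

/-- `Λ°` is a valuation monoid of `Λ` (App. A.2, p. 62: "for any element `m ∈ Λ` the monoid `Λ°`
contains at least one element from the set `{m, m⁻¹}`"). [cite: Temkin2013, Section A.2 (p. 62)] -/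
theorem mem_valuationMonoid_or_inv_mem (γ : (ValueGroup O)ˣ) :
    γ ∈ valuationMonoid O ∨ γ⁻¹ ∈ valuationMonoid O := by
  rcases le_total (γ : ValueGroup O) 1 with h | h
  · exact Or.inl h
  · right
    rw [mem_valuationMonoid_iff, Units.val_inv_eq_inv_val]
    exact inv_le_one_of_one_le₀ h

/-- The value of a non-zero element of `K°` lies in `Λ°`. [folklore] -/
theorem mk0_valuation_mem_valuationMonoid {a : K} (ha : a ≠ 0) (haO : a ∈ O) :
    Units.mk0 (O.valuation a) (valuation_ne_zero_of_ne_zero O ha) ∈ valuationMonoid O :=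
  (O.valuation_le_one_iff a).mpr haO

/-- A **toric monoid `M ⊆ Λ` with `M^gp = Λ`** (Temkin 2013, §5.3, p. 55: "Next portion of notation
will be associated with a toric monoid `M ⊂ Λ` such that `M^gp = Λ`"; App. A.1, p. 62: a toric
monoid is a finitely generated integral monoid, saturated in its group of fractions, the latter a
lattice): `M` is finitely generated, saturated in `Λ` (`γⁿ ∈ M`, `n > 0` ⇒ `γ ∈ M`) and generates
`Λ` as a group. (Integrality and torsion-freeness are automatic inside the lattice `Λ`.)
[cite: Temkin2013, Section 5.3 (p. 55) and Section A.1 (p. 62)] -/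
def IsToricMonoid (M : Submonoid (ValueGroup O)ˣ) : Prop :=
  M.FG ∧ (∀ (γ : (ValueGroup O)ˣ) (n : ℕ), 0 < n → γ ^ n ∈ M → γ ∈ M) ∧
    Subgroup.closure (M : Set (ValueGroup O)ˣ) = ⊤

/-- "`|m| ∈ M`" for an element `m ∈ K` and a set of values `M ⊆ Λ = |K^×|`. [folklore] -/
def ValMem (M : Submonoid (ValueGroup O)ˣ) (m : K) : Prop :=
  ∃ γ ∈ M, (γ : ValueGroup O) = O.valuation m

/-- Unfolding `ValMem`. [folklore] -/
theorem valMem_iff {M : Submonoid (ValueGroup O)ˣ} {m : K} :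
    ValMem O M m ↔ ∃ γ ∈ M, (γ : ValueGroup O) = O.valuation m := Iff.rfl

/-- An element with a value in `M ⊆ Λ = |K^×|` is non-zero. [folklore] -/
theorem ValMem.ne_zero {M : Submonoid (ValueGroup O)ˣ} {m : K} (h : ValMem O M m) : m ≠ 0 := by
  rintro rfl
  obtain ⟨γ, -, hγ⟩ := h
  simp at hγ

/-- For `m ≠ 0`: `|m| ∈ M` iff the unit `|m|` of the value group lies in `M`. [folklore] -/
theorem valMem_iff_mk0_mem {M : Submonoid (ValueGroup O)ˣ} {m : K} (hm : m ≠ 0) :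
    ValMem O M m ↔ Units.mk0 (O.valuation m) (valuation_ne_zero_of_ne_zero O hm) ∈ M := by
  constructor
  · rintro ⟨γ, hγM, hγ⟩
    convert hγM
    exact Units.ext hγ.symm
  · intro h
    exact ⟨_, h, rfl⟩

/-- `ValMem` is monotone in `M`. [folklore] -/
theorem ValMem.mono {M M' : Submonoid (ValueGroup O)ˣ} (h : M ≤ M') {m : K} (hm : ValMem O M m) :
    ValMem O M' m := by
  obtain ⟨γ, hγ, e⟩ := hm
  exact ⟨γ, h hγ, e⟩

/-- `|m|, |m'| ∈ M ⇒ |m m'| ∈ M`. [folklore] -/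
theorem ValMem.mul {M : Submonoid (ValueGroup O)ˣ} {m m' : K} (hm : ValMem O M m)
    (hm' : ValMem O M m') : ValMem O M (m * m') := by
  obtain ⟨γ, hγ, e⟩ := hm
  obtain ⟨γ', hγ', e'⟩ := hm'
  exact ⟨γ * γ', M.mul_mem hγ hγ', by rw [Units.val_mul, e, e', map_mul]⟩

/-- `|1| ∈ M`. [folklore] -/
theorem valMem_one (M : Submonoid (ValueGroup O)ˣ) : ValMem O M (1 : K) :=
  ⟨1, M.one_mem, by simp⟩

/-- If `M ⊆ Λ°` then elements with value in `M` lie in `K°`. [folklore] -/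
theorem ValMem.mem_valuationSubring {M : Submonoid (ValueGroup O)ˣ} (hM : M ≤ valuationMonoid O)
    {m : K} (hm : ValMem O M m) : m ∈ O := by
  obtain ⟨γ, hγ, e⟩ := hm
  rw [← O.valuation_le_one_iff, ← e]
  exact hM hγ

/-! ### Abhyankar transcendence bases -/

/-- An **Abhyankar transcendence basis** `B = B_E ⊔ B_F` of the valued field `(K, K°)` over the
trivially valued subfield `k ⊆ K°` (Temkin 2013, §2.1, pp. 9–10, condition (*): "`|b| = 1` for any
`b ∈ B_F` and the reduction maps `B_F` bijectively onto a transcendence basis `B̃_F` of `l̃` over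
`k̃`, and the projection of `l^×` onto the "multiplicative" `ℚ`-vector space `(|l^×|/|k^×|) ⊗_ℤ ℚ`
maps `B_E` bijectively onto a `ℚ`-basis"; "If `l/k` admits a transcendence basis `B` that
satisfies (*) then we say that `l/k` is Abhyankar … and `B` is an Abhyankar transcendence basis"),
as two finite families `x = B_E`, `y = B_F`: the `x j` are non-zero with `ℤ`-independent values
generating a subgroup of finite index of `Λ = |K^×|` (a `ℚ`-basis of `Λ ⊗ ℚ`; `|k^×| = 1`), the
`y i ∈ K°` have residues forming a transcendence basis of `K̃` over `k = k̃`, and `x ⊔ y` is a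
transcendence basis of `K/k`. [cite: Temkin2013, Section 2.1 (pp. 9–10)] -/
structure IsAbhyankarBasis (hk : ∀ c : k, algebraMap k K c ∈ O) {κ ι : Type*} (x : κ → K)
    (y : ι → O) : Prop where
  ne_zero : ∀ j, x j ≠ 0
  linearIndependent : LinearIndependent ℤ fun j =>
    Additive.ofMul (Units.mk0 (O.valuation (x j)) (valuation_ne_zero_of_ne_zero O (ne_zero j)))
  exists_pow_mem_closure : ∀ γ : (ValueGroup O)ˣ, ∃ n : ℕ, 0 < n ∧
    γ ^ n ∈ Subgroup.closure (Set.range fun j =>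
      Units.mk0 (O.valuation (x j)) (valuation_ne_zero_of_ne_zero O (ne_zero j)))
  isTranscendenceBasis_residue :
    letI := algebraOfMem k O hk
    IsTranscendenceBasis k fun i => residue O (y i)
  isTranscendenceBasis : IsTranscendenceBasis k (Sum.elim x fun i => (y i : K))

namespace IsAbhyankarBasis

variable {O} {hk : ∀ c : k, algebraMap k K c ∈ O} {κ ι : Type*} {x : κ → K} {y : ι → O}

/-- The residues of `B_F` are algebraically independent over `k`. [folklore] -/
theorem algebraicIndependent_residue (hB : IsAbhyankarBasis O hk x y) :
    letI := algebraOfMem k O hk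
    AlgebraicIndependent k fun i => residue O (y i) :=
  hB.isTranscendenceBasis_residue.1

/-- The elements of `B_F` are units of `K°`: `|y i| = 1` (their residues are non-zero). [folklore] -/
theorem valuation_eq_one (hB : IsAbhyankarBasis O hk x y) (i : ι) : O.valuation (y i : K) = 1 := by
  letI := algebraOfMem k O hk
  have hne : residue O (y i) ≠ 0 := hB.algebraicIndependent_residue.ne_zero i
  have hunit : IsUnit (y i) := by
    by_contra h
    exact hne ((residue_eq_zero_iff _).mpr ((mem_maximalIdeal _).mpr (mem_nonunits_iff.mpr h)))
  exact (O.valuation_eq_one_iff _).mp hunit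

/-- … in particular they are non-zero. [folklore] -/
theorem coe_ne_zero (hB : IsAbhyankarBasis O hk x y) (i : ι) : (y i : K) ≠ 0 := fun h => by
  have := hB.valuation_eq_one i
  rw [h, map_zero] at this
  exact zero_ne_one this

end IsAbhyankarBasis

/-! ### Toric charts `A_{B,M} = Spec k[M_B]` -/

/-- The **toric chart** `k[M_B]` of an Abhyankar basis `B = x ⊔ y` and a monoid of values `M ⊆ Λ`
(Temkin 2013, §5.3, p. 55: "`M_B° := M ∩ Λ_B` … We set `M_B = P_B^× ⊕ M_B°` and define a toric chart
`A_{B,M} = Spec(k[M_B])`", `P_B^×` the free abelian group on `B_F`, `Λ_B` the lattice generated by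
`|B_E|`, identified with the Laurent monomials in `B_E` via `i_B`): the `k`-subalgebra of `K`
generated by the `y i`, their inverses, and the Laurent monomials `x^d` whose value lies in `M`.
[cite: Temkin2013, Section 5.3 (p. 55)] -/
def toricChart {κ ι : Type*} (x : κ → K) (y : ι → O) (M : Submonoid (ValueGroup O)ˣ) :
    Subalgebra k K :=
  Algebra.adjoin k ((Set.range fun i => (y i : K)) ∪ (Set.range fun i => (y i : K)⁻¹) ∪
    {m | ValMem O M m ∧ ∃ d : κ →₀ ℤ, (d.prod fun j n => x j ^ n) = m})

section Chart

variable {O} {κ ι : Type*} (x : κ → K) (y : ι → O)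

/-- `B_F ⊆ k[M_B]`. [folklore] -/
theorem coe_mem_toricChart (M : Submonoid (ValueGroup O)ˣ) (i : ι) :
    (y i : K) ∈ toricChart (k := k) O x y M :=
  Algebra.subset_adjoin (Or.inl (Or.inl ⟨i, rfl⟩))

/-- `B_F^{-1} ⊆ k[M_B]`. [folklore] -/
theorem inv_coe_mem_toricChart (M : Submonoid (ValueGroup O)ˣ) (i : ι) :
    (y i : K)⁻¹ ∈ toricChart (k := k) O x y M :=
  Algebra.subset_adjoin (Or.inl (Or.inr ⟨i, rfl⟩))

/-- The Laurent monomials `x^d` with `|x^d| ∈ M` lie in `k[M_B]`. [folklore] -/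
theorem lmonomial_mem_toricChart {M : Submonoid (ValueGroup O)ˣ} (d : κ →₀ ℤ)
    (hd : ValMem O M (d.prod fun j n => x j ^ n)) :
    (d.prod fun j n => x j ^ n) ∈ toricChart (k := k) O x y M :=
  Algebra.subset_adjoin (Or.inr ⟨hd, d, rfl⟩)

/-- Charts grow with `M`. [folklore] -/
theorem toricChart_mono {M M' : Submonoid (ValueGroup O)ˣ} (h : M ≤ M') :
    toricChart (k := k) O x y M ≤ toricChart O x y M' := by
  refine Algebra.adjoin_mono ?_
  rintro m (hm | ⟨hm, d, rfl⟩)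
  · exact Or.inl hm
  · exact Or.inr ⟨hm.mono O h, d, rfl⟩

/-- **Lemma 5.3.1, (iii) ⇒ (i)** in the form needed here: if `M ⊆ Λ°` (and `|y i| = 1`) then
`k[M_B] ⊆ K°`. [cite: Temkin2013, Lemma 5.3.1 (p. 55)] -/
theorem toricChart_le_valuationSubring (hk : ∀ c : k, algebraMap k K c ∈ O)
    (hy : ∀ i, O.valuation (y i : K) = 1) {M : Submonoid (ValueGroup O)ˣ}
    (hM : M ≤ valuationMonoid O) : (toricChart (k := k) O x y M).toSubring ≤ O.toSubring := by
  let O' : Subalgebra k K := { O.toSubring.toSubsemiring with algebraMap_mem' := hk }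
  intro m hm
  refine (show toricChart (k := k) O x y M ≤ O' from Algebra.adjoin_le ?_) hm
  rintro m ((⟨i, rfl⟩ | ⟨i, rfl⟩) | ⟨hm, -, -⟩)
  · exact (y i).2
  · change (y i : K)⁻¹ ∈ O
    rw [← O.valuation_le_one_iff, map_inv₀, hy i, inv_one]
  · exact hm.mem_valuationSubring O hM

end Chart

/-! ### Normalization `X_{B,M} = Nr_K(A_{B,M})` and the local ring `A_{B,M}` of the centre -/

/-- The **`K`-normalization** `Nr_K(C)` of a `k`-subalgebra `C ⊆ K`: the integral closure of `C`
in `K`, as a `k`-subalgebra (Temkin 2013, §2.3, p. 13: "`Nr_B(A)` [is] the integral closure of the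
image of `A` in `B`"; §5.4, p. 56: "`X_{B,M} := Nr_K(A_{B,M})`").
[cite: Temkin2013, Section 2.3 (p. 13) and Section 5.4 (p. 56)] -/
def nrAlg (C : Subalgebra k K) : Subalgebra k K :=
  (integralClosure C K).restrictScalars k

section Nr

variable {O}

/-- Membership in `Nr_K(C)` is integrality over `C`. [folklore] -/
@[simp] theorem mem_nrAlg_iff {C : Subalgebra k K} {z : K} : z ∈ nrAlg C ↔ IsIntegral C z :=
  Iff.rfl

/-- `C ⊆ Nr_K(C)`. [folklore] -/
theorem le_nrAlg (C : Subalgebra k K) : C ≤ nrAlg C := fun z hz =>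
  (mem_nrAlg_iff).mpr (isIntegral_algebraMap (R := C) (x := ⟨z, hz⟩))

/-- `Nr_K` is monotone. [folklore] -/
theorem nrAlg_mono {C C' : Subalgebra k K} (h : C ≤ C') : nrAlg C ≤ nrAlg C' := fun z hz => by
  rw [mem_nrAlg_iff] at hz ⊢
  exact IsIntegral.tower_top (A := C') (hz.map_of_comp_eq (Subalgebra.inclusion h).toRingHom
    (RingHom.id K) (by ext; rfl))

/-- Valuation rings are integrally closed: `C ⊆ K°` ⇒ `Nr_K(C) ⊆ K°`. [folklore] -/
theorem nrAlg_le_valuationSubring {C : Subalgebra k K} (hC : C.toSubring ≤ O.toSubring) :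
    (nrAlg C).toSubring ≤ O.toSubring := fun _ hz =>
  mem_of_isIntegral_of_le (V := O) (S := C.toSubring) hC ((mem_nrAlg_iff).mp hz)

/-- The `k[M_B]`-algebra structure of `Nr_K(C) ⊇ C` (the finite projection
`f : X = Nr_K(Spec C) → Spec C`). [folklore] -/
instance nrAlg.algebra (C : Subalgebra k K) : Algebra C (nrAlg C) :=
  (Subalgebra.inclusion (le_nrAlg C)).toRingHom.toAlgebra

/-- Compatibility of `C → Nr_K(C) → K`. [folklore] -/
instance nrAlg.isScalarTower (C : Subalgebra k K) : IsScalarTower C (nrAlg C) K :=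
  IsScalarTower.of_algebraMap_eq fun _ => rfl

/-- The structure map `C → Nr_K(C)` is the inclusion. [folklore] -/
@[simp] theorem nrAlg.coe_algebraMap (C : Subalgebra k K) (c : C) :
    ((algebraMap C (nrAlg C) c : nrAlg C) : K) = c := rfl

end Nr

/-- The **local ring of the centre** of `K°` on an affine model `Spec N`, `N ⊆ K°`, as a subring
of `K` (Temkin 2013, §5.4, p. 56: "let `x_{B,M} ∈ X_{B,M}` denote the center of `K°` and let
`A_{B,M}` be the local ring of `x_{B,M}`"): the fractions `a / b` with `a, b ∈ N` and `|b| = 1`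
(i.e. `b ∉ 𝔪_{K°} ∩ N`). [cite: Temkin2013, Section 5.4 (p. 56)] -/
def centreLocalRing (N : Subalgebra k K) : Subalgebra k K where
  carrier := {z | ∃ a ∈ N, ∃ b ∈ N, O.valuation b = 1 ∧ z = a / b}
  mul_mem' := by
    rintro _ _ ⟨a, ha, b, hb, hb1, rfl⟩ ⟨a', ha', b', hb', hb'1, rfl⟩
    exact ⟨a * a', N.mul_mem ha ha', b * b', N.mul_mem hb hb', by rw [map_mul, hb1, hb'1, mul_one],
      by rw [div_mul_div_comm]⟩
  one_mem' := ⟨1, N.one_mem, 1, N.one_mem, map_one _, by simp⟩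
  add_mem' := by
    rintro _ _ ⟨a, ha, b, hb, hb1, rfl⟩ ⟨a', ha', b', hb', hb'1, rfl⟩
    have hb0 : b ≠ 0 := fun h => by simp [h] at hb1
    have hb'0 : b' ≠ 0 := fun h => by simp [h] at hb'1
    exact ⟨a * b' + a' * b, N.add_mem (N.mul_mem ha hb') (N.mul_mem ha' hb), b * b',
      N.mul_mem hb hb', by rw [map_mul, hb1, hb'1, mul_one], by
        rw [div_add_div _ _ hb0 hb'0]; ring⟩
  zero_mem' := ⟨0, N.zero_mem, 1, N.one_mem, map_one _, by simp⟩
  algebraMap_mem' c := ⟨algebraMap k K c, N.algebraMap_mem c, 1, N.one_mem, map_one _, by simp⟩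

section LocalRing

variable {O}

/-- Unfolding `centreLocalRing`. [folklore] -/
theorem mem_centreLocalRing_iff {N : Subalgebra k K} {z : K} :
    z ∈ centreLocalRing O N ↔ ∃ a ∈ N, ∃ b ∈ N, O.valuation b = 1 ∧ z = a / b := Iff.rfl

/-- `N ⊆ N_𝔭`. [folklore] -/
theorem le_centreLocalRing (N : Subalgebra k K) : N ≤ centreLocalRing O N := fun z hz =>
  ⟨z, hz, 1, N.one_mem, map_one _, by simp⟩

/-- `a / b ∈ N_𝔭` for `a, b ∈ N`, `|b| = 1`. [folklore] -/
theorem div_mem_centreLocalRing {N : Subalgebra k K} {a b : K} (ha : a ∈ N) (hb : b ∈ N)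
    (hb1 : O.valuation b = 1) : a / b ∈ centreLocalRing O N :=
  ⟨a, ha, b, hb, hb1, rfl⟩

/-- `centreLocalRing` is monotone in `N`. [folklore] -/
theorem centreLocalRing_mono {N N' : Subalgebra k K} (h : N ≤ N') :
    centreLocalRing O N ≤ centreLocalRing O N' := by
  rintro _ ⟨a, ha, b, hb, hb1, rfl⟩
  exact ⟨a, h ha, b, h hb, hb1, rfl⟩

/-- `N ⊆ K°` ⇒ `A = N_𝔭 ⊆ K°`. [folklore] -/
theorem centreLocalRing_le_valuationSubring {N : Subalgebra k K} (hN : N.toSubring ≤ O.toSubring) :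
    (centreLocalRing O N).toSubring ≤ O.toSubring := by
  rintro _ ⟨a, ha, b, hb, hb1, rfl⟩
  change a / b ∈ O
  rw [← O.valuation_le_one_iff, map_div₀, hb1, div_one, O.valuation_le_one_iff]
  exact hN ha

/-- Units of the local ring: `a / b` with `a, b ∈ N` and `|a| = 1` has its inverse `b / a` in
`A`. [folklore] -/
theorem inv_mem_centreLocalRing {N : Subalgebra k K} {a b : K} (ha : a ∈ N) (hb : b ∈ N)
    (ha1 : O.valuation a = 1) : (a / b)⁻¹ ∈ centreLocalRing O N :=
  ⟨b, hb, a, ha, ha1, by rw [inv_div]⟩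

end LocalRing

/-! ### The toroidal models: notation -/

section Toroidal

variable {O} {κ ι : Type*} (x : κ → K) (y : ι → O)

/-- `X_{B,M} ⊆ K°` for `M ⊆ Λ°`: the normalization of the chart lies in the valuation ring.
[cite: Temkin2013, Section 5.4 (p. 56)] -/
theorem nrAlg_toricChart_le (hk : ∀ c : k, algebraMap k K c ∈ O)
    (hy : ∀ i, O.valuation (y i : K) = 1) {M : Submonoid (ValueGroup O)ˣ}
    (hM : M ≤ valuationMonoid O) :
    (nrAlg (toricChart (k := k) O x y M)).toSubring ≤ O.toSubring :=
  nrAlg_le_valuationSubring (toricChart_le_valuationSubring x y hk hy hM)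

/-- `A_{B,M} ⊆ K°` for `M ⊆ Λ°`. [cite: Temkin2013, Section 5.4 (p. 56)] -/
theorem centreLocalRing_nrAlg_toricChart_le (hk : ∀ c : k, algebraMap k K c ∈ O)
    (hy : ∀ i, O.valuation (y i : K) = 1) {M : Submonoid (ValueGroup O)ˣ}
    (hM : M ≤ valuationMonoid O) :
    (centreLocalRing O (nrAlg (toricChart (k := k) O x y M))).toSubring ≤ O.toSubring :=
  centreLocalRing_le_valuationSubring (nrAlg_toricChart_le x y hk hy hM)

/-- The rings `A_{B,M}` grow with `M`. [folklore] -/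
theorem centreLocalRing_nrAlg_toricChart_mono {M M' : Submonoid (ValueGroup O)ˣ} (h : M ≤ M') :
    centreLocalRing O (nrAlg (toricChart (k := k) O x y M)) ≤
      centreLocalRing O (nrAlg (toricChart O x y M')) :=
  centreLocalRing_mono (nrAlg_mono (toricChart_mono x y h))

end Toroidal

/-! ### The named facts -/

/-- NAMED FACT — **Temkin 2013, Prop. 5.4.3 (independence of the Abhyankar basis)** (p. 57: "Let
`B` and `B'` be two Abhyankar bases. Then for any sufficiently large toric monoid `M ⊂ Λ°` the
local rings `A_M` and `A'_M` in `K` coincide, and for any `m ∈ M ∩ Λ_B ∩ Λ_{B'}` one has that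
`i_B(m) = u i_{B'}(m)` for a unit `u ∈ A_M^×`. In particular, the divisors on `Spec(A_M)` induced
from `E_M` and `E'_M` coincide"). Setting (§5.3, p. 54): `k` trivially valued, `K/k` a finitely
generated Abhyankar extension (`D_{K/k} = 0`), `A_M = A_{B,M}`, `A'_M = A_{B',M}` the local rings of
the centres of `K°` on `Nr_K(k[M_B])`, `Nr_K(k[M_{B'}])`. Rendering: "sufficiently large" in the
pedantic form of p. 55; `m ∈ M ∩ Λ_B ∩ Λ_{B'}` ↦ a value in `M` which is the value of a Laurent
monomial `x^d` in `B_E` and of one `x'^{d'}` in `B'_E` (`i_B(m) = x^d`, `i_{B'}(m) = x'^{d'}`); the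
unit `u` ↦ `u, u⁻¹ ∈ A_{B,M}`. The last (divisorial) sentence is not rendered. The printed proof
rests on the Riemann–Zariski spaces of §2.4 (Lemma 2.4.1, Cor. 2.4.3), Lemma 5.4.1, Cor. 5.4.2 and
Lemma 5.4.4 (which uses [EGA IV₄ 17.7.8] and Thm. 2.5.5). Users take `(h : Temkin2013_Prop543)`.
[cite: Temkin2013, Prop. 5.4.3 (p. 57)] -/
def Temkin2013_Prop543 : Prop :=
  ∀ (k K : Type u) [Field k] [Field K] [Algebra k K], (⊤ : IntermediateField k K).FG →
    ∀ (O : ValuationSubring K) (hk : ∀ c : k, algebraMap k K c ∈ O),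
      transcendenceDefect k O hk = 0 →
    ∀ (E F : ℕ) (x : Fin E → K) (y : Fin F → O), IsAbhyankarBasis O hk x y →
    ∀ (E' F' : ℕ) (x' : Fin E' → K) (y' : Fin F' → O), IsAbhyankarBasis O hk x' y' →
      ∃ M₀ : Submonoid (ValueGroup O)ˣ, IsToricMonoid O M₀ ∧ M₀ ≤ valuationMonoid O ∧
        ∀ M : Submonoid (ValueGroup O)ˣ, IsToricMonoid O M → M₀ ≤ M → M ≤ valuationMonoid O →
          centreLocalRing O (nrAlg (toricChart (k := k) O x y M)) =
            centreLocalRing O (nrAlg (toricChart (k := k) O x' y' M)) ∧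
          ∀ (d : Fin E →₀ ℤ) (d' : Fin E' →₀ ℤ),
            O.valuation (d.prod fun j n => x j ^ n) = O.valuation (d'.prod fun j n => x' j ^ n) →
            ValMem O M (d.prod fun j n => x j ^ n) →
            ∃ u ∈ centreLocalRing O (nrAlg (toricChart (k := k) O x y M)),
              u⁻¹ ∈ centreLocalRing O (nrAlg (toricChart (k := k) O x y M)) ∧
              (d.prod fun j n => x j ^ n) = u * d'.prod fun j n => x' j ^ n

/-- NAMED FACT — **Temkin 2013, Thm. 5.5.1 (iii) (the adapted toroidal model is étale over its
toric chart)** (p. 59: "Assume that `K` is an Abhyankar valued field finitely generated over a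
trivially valued field `k`, `K̃` is separable over `k` and `B` is an Abhyankar transcendence basis
of `K` over `k`, and keep other notation of §§5.3–5.4. Then there exists a toric monoid `M₀ ⊂ Λ°`
such that for any toric monoid `M` with `M₀ ⊆ M ⊆ Λ°` the following conditions are satisfied: …
(iii) If `B̃_F` is a separating transcendence basis of `K̃` and `|B_E|` is a basis of `|K^×|` then
`f_{B,M}` is étale at `x_{B,M}`"; `f_{B,M} : X_{B,M} = Nr_K(A_{B,M}) → A_{B,M} = Spec k[M_B]` the
projection, `x_{B,M}` the centre of `K°`). Rendering: the hypotheses of (iii) make "`K̃` separable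
over `k`" automatic; "`B̃_F` separating transcendence basis" ↦ transcendence basis (part of
`IsAbhyankarBasis`) with `K̃` separable (algebraic) over `k(B̃_F)`; "`|B_E|` a basis of `|K^×|`" ↦
the values of the `x j` generate `Λ` (they are `ℤ`-independent by `IsAbhyankarBasis`); "étale at
`x_{B,M}`" ↦ `Algebra.IsEtaleAt k[M_B] 𝔭`, `𝔭` the centre of `K°` on `Nr_K(k[M_B])`. Parts (i),
(ii) (log smoothness, Kummer property, `M̄ ⥲ N̄_{T,t}`) are not rendered. The printed proof:
`K/K_B` is unramified (stability of `K_B`, Remark 2.1.3), Lemma 5.3.2, spreading out of the étale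
`Spec K° → Spec K_B°` by [EGA IV₄ 17.7.8], and openness of `Y` in `Nr_K(Z)`. Users take
`(h : Temkin2013_Thm551iii)`. [cite: Temkin2013, Thm. 5.5.1 (iii) (p. 59)] -/
def Temkin2013_Thm551iii : Prop :=
  ∀ (k K : Type u) [Field k] [Field K] [Algebra k K], (⊤ : IntermediateField k K).FG →
    ∀ (O : ValuationSubring K) (hk : ∀ c : k, algebraMap k K c ∈ O),
      transcendenceDefect k O hk = 0 →
    ∀ (E F : ℕ) (x : Fin E → K) (y : Fin F → O) (hB : IsAbhyankarBasis O hk x y),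
      Subgroup.closure (Set.range fun j =>
        Units.mk0 (O.valuation (x j)) (valuation_ne_zero_of_ne_zero O (hB.ne_zero j))) = ⊤ →
      (letI := algebraOfMem k O hk
       ∀ z : ResidueField O,
        IsSeparable (IntermediateField.adjoin k (Set.range fun i => residue O (y i))) z) →
      ∃ M₀ : Submonoid (ValueGroup O)ˣ, IsToricMonoid O M₀ ∧ M₀ ≤ valuationMonoid O ∧
        ∀ (M : Submonoid (ValueGroup O)ˣ), IsToricMonoid O M → M₀ ≤ M →
          ∀ hM : M ≤ valuationMonoid O,
          Algebra.IsEtaleAt (toricChart (k := k) O x y M)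
            (centreIdeal (nrAlg (toricChart (k := k) O x y M)) O
              (nrAlg_toricChart_le x y hk hB.valuation_eq_one hM))

/-- NAMED FACT — **Temkin 2013, Thm. 5.5.3 (residual separability after a purely inseparable
extension of the constants)** (p. 61: "If `K` is a finitely generated Abhyankar valued field over
`k` then there exists a finite purely inseparable extension `l/k` such that for any finite purely
inseparable extension `l'/l` the field `l̃'K` is separable over `l'`"; `k` trivially valued, `l'K`
carrying the valuation extending that of `K`, unique as `l'K/K` is purely inseparable). Rendering:
`l`, `l'` are types with `k → l → l'`; the compositum `l'K` ↦ any field `K'` with compatible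
structure maps from `K` and `l'` and `Algebra.adjoin K l' = ⊤`; its valuation ↦ any valuation ring
`O'` of `K'` over `K°` (then `l' ⊆ O'`, `l'` being algebraic over `k ⊆ K°`; this is the hypothesis
`hl'`); "separable over `l'`" for the finitely generated residue field (Remark 2.1.3) ↦ separably
generated: a finite transcendence basis `s` over `l'` with every element separable over `l'(s)`,
i.e. a separating transcendence basis (equivalent for finitely generated extensions, and the form
used on p. 59). The printed
proof uses the stability of Abhyankar fields over the perfection `k^{1/p^∞}` (Remark 2.1.3, [Kuh])
and the Galois theory of valued fields (tame / wild / purely inseparable splitting). Users take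
`(h : Temkin2013_Thm553)`. [cite: Temkin2013, Thm. 5.5.3 (p. 61)] -/
def Temkin2013_Thm553 : Prop :=
  ∀ (k K : Type u) [Field k] [Field K] [Algebra k K], (⊤ : IntermediateField k K).FG →
    ∀ (O : ValuationSubring K) (hk : ∀ c : k, algebraMap k K c ∈ O),
      transcendenceDefect k O hk = 0 →
      ∃ (l : Type u) (_ : Field l) (_ : Algebra k l), FiniteDimensional k l ∧ IsPurelyInseparable k l ∧
        ∀ (l' : Type u) [Field l'] [Algebra k l'] [Algebra l l'] [IsScalarTower k l l'],
          FiniteDimensional k l' → IsPurelyInseparable k l' →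
        ∀ (K' : Type u) [Field K'] [Algebra K K'] [Algebra l' K'] [Algebra k K']
          [IsScalarTower k K K'] [IsScalarTower k l' K'],
          Algebra.adjoin K (Set.range (algebraMap l' K')) = ⊤ →
        ∀ (O' : ValuationSubring K'), O'.comap (algebraMap K K') = O →
        ∀ hl' : (∀ c : l', algebraMap l' K' c ∈ O'),
          letI := algebraOfMem l' O' hl'
          ∃ s : Finset (ResidueField O'),
            IsTranscendenceBasis l' ((↑) : s → ResidueField O') ∧
            ∀ z : ResidueField O', IsSeparable (IntermediateField.adjoin l' (s : Set (ResidueField O'))) z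

end Literature.AlgebraicGeometry.Resolution

end
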